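import Literature.MathematicalPhysics.QuantumFieldTheory.Balaban1983to89.T3HeightwiseDensityBounds
import Literature.MathematicalPhysics.QuantumFieldTheory.Balaban1983to89.T3ConstrainedMinimiser
import Summits.QuantumFields.YangMills.Theorems.AlphaInputsT3ACEnvelope
import HarnessLib

/-!
# `FluctuationComparisonRegPrIntLHeightwiseQuotientOfBounds5` — (Q5): THE QUOTIENT READING OF BAŁABAN'S THEOREM 1 (5), BOTH HALVES, WITH (6)
# DISCHARGED — the K-UNIFORM letters ⟨UP⟩∕⟨LOW⟩ of PERS₁∘ `OneLoopPersistenceIntCan`'s σ-free path, in print's OWN normalisation `e^{−E_K}·ρ`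
# (crux `UnitScaleTilt.FluctuationComparisonRegPrIntL`, stmt-QuantumFields-20520; LINE g22-2∕g22-4 row PERS₁∘)

Cell `ym3-torus` (YM ladder rung R3 = continuum SU(2) Yang–Mills on T³ — a RUNG, NOT the Clay problem: not d = 4, not infinite volume, not a mass gap);
width seat `ym-ust-20520-w5` (gen 17); helper `--supports stmt-QuantumFields-20520`.  THEOREMS ONLY (0 `def`, 0 `sorry`, default heartbeats).

WHY.  LEAD w3-20520 g18 docked PERS₁∘'s K-uniform side to the literature schemas of `T3HeightwiseDensityBounds` in the QUOTIENT currency `Z_K⁻¹ρ_{K−n}`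
(`HeightwiseUpperBound F γ` = ⟨UP⟩, `HeightwiseLowerBoundOnSmall F γ` = ⟨LOW on small⟩).  Print states Theorem 1 as the two-sided bound (5) p. 256 for the densities
`ρ_k = e^{−E}·T^k e^{−A∕g₀²}` in Bałaban's normalisation (the run constant `E` of (1) «including normalization terms and vacuum energy renormalization counterterms»),
and DERIVES (6) from it: p. 257 «∫dU ρ_k = ∫dU T^kρ₀ = ∫dU ρ₀ = Z^ε … imply uniform in ε bounds for the partition function Z^ε».  The literature file records (6) as a
separate schema `PartitionBounds6` and converts only the UPPER half to the quotient (✓`heightwiseUpperBound_of_bounds5`).  This file supplies the rest: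
* §1 ★`integral_heightDensity_univ_eq_partitionFn` — (6)'s IDENTITY ON THE TOWER: `∫ heightDensity F γ hK univ ∂dU_n = Z_K` (`γ ≥ 0`; ✓`integral_resDensity_mul` at `f ≡ 1`
  and `fieldShift` measure preservation);
* §2 generic quotient algebra on a probability space (★`twoSided_integral_bounds`, ★`quotient_upper_ae`, ★`quotient_lower_ae`): a density `h ≥ 0` with a free factor
  `w > 0`, `w·h ≤ M` a.e. and `m ≤ w·h` a.e. on a set `S` of positive mass ⟹ `w·∫h ∈ [m·μ S, M]`, `(∫h)⁻¹h ≤ M∕(m·μ S)` a.e., `m∕M ≤ (∫h)⁻¹h` a.e. on `S`;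
* §3 ★★`partitionBounds6_of_bounds5TwoSided` — lit `PartitionBounds6 F γ E` VERBATIM from `Bounds5UpperAtHeight F γ E` + ⟨(5)-LOWER ON SMALL AT HEIGHT 0⟩ (inline hypothesis,
  normalisation `E`; window charge ✓`fieldMeasure_plaqSmall_pos`);  ★★★`heightwiseUpperBound_of_bounds5TwoSided` — lit `HeightwiseUpperBound F γ`;
  ★★★`heightwiseLowerBoundOnSmall_of_bounds5TwoSided` — lit `HeightwiseLowerBoundOnSmall F γ` VERBATIM from ⟨(5)-LOWER ON SMALL AT EVERY HEIGHT⟩ + `Bounds5UpperAtHeight`;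
* §4 ★`bounds5LowerOnSmall_of_minimiserShape` — print's literal lower currency `χ·exp[−(1∕g_k²)A^η(U_k(U)) − O(1)|T₁^{(k)}|]` with `(1∕g_k²)A^η(U_k(U)) = β_K·minAction`
  (lit `T3ConstrainedMinimiser.minAction`, the constrained minimum of the fine Wilson action over the fibre) + the DISPLAYED regularity letter `β_K·minAction ≤ A₀` on the
  small set ([Balaban1985Variational] Thm 1 reading) ⟹ the folded lower letter of §3.
NET (census): PERS₁∘'s K-uniform debt ⟸ THM 1 (5) AT HEIGHTS 0 AND n, BOTH HALVES, free `E_K` — (6) and the quotient conversion are bookkeeping.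
HONEST SCOPE.  Doors; (5)∕Thm 1 is NOT proved (for the pinned `ℰp` densities it is the cell's construction statement, lit docstring); ⟨UP⟩∕⟨LOW⟩∕PERS₁∘∕TUBE∘∕LFR♯ᶜ∘∕
S2β∕20520∕`YM3TorusSU2` NOT proved; the Yang–Mills mass gap is NOT proved.
HYP-SAT (cell RULING №42).  Hypotheses = print's (5) halves at fixed heights, constants after `n`, before `K`, one free `E : ℕ → ℝ`; class (1) conditional door.
References: [Balaban1985UV3] (1)–(6) pp.256–257, Thm 1 p.257, (47) p.267; [Balaban1985Averaging] (10) p.19; [Balaban1985Variational] Thm 1 p.279.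
-/

noncomputable section

set_option autoImplicit false

open MeasureTheory Filter Topology Set
open scoped ENNReal
open Literature.MathematicalPhysics.QuantumFieldTheory.Balaban1983to89
open Literature.MathematicalPhysics.QuantumFieldTheory.Balaban1983to89.T3ContinuumYM3Torus
open Literature.MathematicalPhysics.QuantumFieldTheory.Balaban1983to89.T3LevelShift
open Literature.MathematicalPhysics.QuantumFieldTheory.Balaban1983to89.T3UnitLawDensityEML
open Literature.MathematicalPhysics.QuantumFieldTheory.Balaban1983to89.T3UnitScaleTilt
open Literature.MathematicalPhysics.QuantumFieldTheory.Balaban1983to89.T3RestrictedUnitDensity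
open Literature.MathematicalPhysics.QuantumFieldTheory.Balaban1983to89.T3TiltDescent
open Literature.MathematicalPhysics.QuantumFieldTheory.Balaban1983to89.T3HeightwiseDensityBounds
open Literature.MathematicalPhysics.QuantumFieldTheory.Balaban1983to89.T3ConstrainedMinimiser
open Literature.MathematicalPhysics.QuantumFieldTheory.Balaban1983to89.Missing

namespace Summit.QuantumFields.YangMills.Theorems.FluctuationComparisonRegPrIntLHeightwiseQuotientOfBounds5

/-! ## §1 (6)'s identity on the tower: the height-`n` density integrates to the partition function of run `K` -/

/-- ★ **`∫ ρ_{K−n} dU_n = Z_K`** — Bałaban's «∫dU ρ_k = ∫dU T^kρ₀ = ∫dU ρ₀ = Z^ε» ((6) p. 257) for the tree's height-`n` density of run `K` (`γ ≥ 0`): the push-forward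
identity ✓`integral_resDensity_mul` at the test function `f ≡ 1`, read through the measure-preserving relabelling `fieldShift`. [cite: Balaban1985UV3, (6) p.257; Balaban1985Averaging, (10) p.19] -/
theorem integral_heightDensity_univ_eq_partitionFn (F : T3Family) {γ : ℝ} (hγ : 0 ≤ γ) {n K : ℕ} (hK : n ≤ K) :
    ∫ V, heightDensity F γ hK Set.univ V ∂fieldMeasure (F.P n) 0 (Matrix.specialUnitaryGroup (Fin 2) ℂ) =
      partitionFn (G := Matrix.specialUnitaryGroup (Fin 2) ℂ) (F.P K) ((F.scheme ℰp γ).β K) := by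
  have hcv : ∫ V, heightDensity F γ hK Set.univ V ∂fieldMeasure (F.P n) 0 (Matrix.specialUnitaryGroup (Fin 2) ℂ) =
      ∫ W, heightDensity F γ hK Set.univ
          (fieldShift (F.sitesPerDir_eq (m := F.m) (K := n) (j := 0) (m' := F.m) (K' := K) (j' := K - n) (by omega)) W)
        ∂fieldMeasure (F.P K) (K - n) (Matrix.specialUnitaryGroup (Fin 2) ℂ) :=
    (integral_comp_fieldShift _ _).symm
  rw [hcv]
  simp_rw [heightDensity_fieldShift]
  have h1 := integral_resDensity_mul F K MeasurableSet.univ hγ (k := K - n) (by omega) (fun _ => (1 : ℝ)) measurable_const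
    ⟨1, fun _ => by simp⟩
  simp only [mul_one, Set.indicator_univ] at h1
  rw [h1]
  rfl

/-! ## §2 Generic quotient algebra on a probability space -/

section Generic

variable {X : Type*} [MeasurableSpace X] {μ : Measure X} [IsProbabilityMeasure μ]

/-- ★ **Two-sided bounds of the total mass from two-sided bounds of the density with a free factor**: `w·h ≤ M` a.e. and `m ≤ w·h` a.e. on a measurable `S`
(`h ≥ 0` integrable, `w > 0`) ⟹ `m·μ S ≤ w·∫h ≤ M`.  ((6) from (5): Bałaban's normalisation `w = e^{−E}` multiplies both.) [cite: Balaban1985UV3, (6) p.257] -/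
theorem twoSided_integral_bounds {h : X → ℝ} (hi : Integrable h μ) (h0 : ∀ x, 0 ≤ h x) {S : Set X} (hS : MeasurableSet S)
    {w M m : ℝ} (hw : 0 < w) (hup : ∀ᵐ x ∂μ, w * h x ≤ M) (hlow : ∀ᵐ x ∂μ, x ∈ S → m ≤ w * h x) :
    m * μ.real S ≤ w * ∫ x, h x ∂μ ∧ w * ∫ x, h x ∂μ ≤ M := by
  have hiw : Integrable (fun x => w * h x) μ := hi.const_mul w
  rw [← integral_const_mul]
  constructor
  · have hS' : ∀ᵐ x ∂(μ.restrict S), m ≤ w * h x := (ae_restrict_iff' hS).mpr hlow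
    calc m * μ.real S = ∫ _ in S, m ∂μ := by rw [setIntegral_const, smul_eq_mul, mul_comm]
      _ ≤ ∫ x in S, w * h x ∂μ := integral_mono_ae (integrable_const m) hiw.integrableOn hS'
      _ ≤ ∫ x, w * h x ∂μ := setIntegral_le_integral hiw (Eventually.of_forall fun x => mul_nonneg hw.le (h0 x))
  · calc ∫ x, w * h x ∂μ ≤ ∫ _, M ∂μ := integral_mono_ae hiw (integrable_const M) hup
      _ = M := by simp

/-- ★ **Quotient upper bound**: under the hypotheses of `twoSided_integral_bounds` with `0 < m` and `0 < μ S`, the NORMALISED density satisfies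
`(∫h)⁻¹·h ≤ M∕(m·μ S)` a.e. — the free factor `w` cancels. [cite: Balaban1985UV3, (5)-(6) pp.256-257] -/
theorem quotient_upper_ae {h : X → ℝ} (hi : Integrable h μ) (h0 : ∀ x, 0 ≤ h x) {S : Set X} (hS : MeasurableSet S) (hSpos : 0 < μ.real S)
    {w M m : ℝ} (hw : 0 < w) (hm : 0 < m) (hup : ∀ᵐ x ∂μ, w * h x ≤ M) (hlow : ∀ᵐ x ∂μ, x ∈ S → m ≤ w * h x) :
    ∀ᵐ x ∂μ, (∫ y, h y ∂μ)⁻¹ * h x ≤ M / (m * μ.real S) := by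
  obtain ⟨hZlow, -⟩ := twoSided_integral_bounds hi h0 hS hw hup hlow
  have hmS : 0 < m * μ.real S := mul_pos hm hSpos
  have hwZ : 0 < w * ∫ y, h y ∂μ := lt_of_lt_of_le hmS hZlow
  filter_upwards [hup] with x hx
  have hM : 0 ≤ M := (mul_nonneg hw.le (h0 x)).trans hx
  have hq : (∫ y, h y ∂μ)⁻¹ * h x = (w * h x) / (w * ∫ y, h y ∂μ) := by
    rw [mul_div_mul_left _ _ hw.ne', div_eq_inv_mul]
  rw [hq]
  calc w * h x / (w * ∫ y, h y ∂μ) ≤ M / (w * ∫ y, h y ∂μ) := div_le_div_of_nonneg_right hx hwZ.le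
    _ ≤ M / (m * μ.real S) := div_le_div_of_nonneg_left hM hmS hZlow

/-- ★ **Quotient lower bound on the small set**: under the same hypotheses, `m∕M ≤ (∫h)⁻¹·h` a.e. on `S` — again `w` cancels. [cite: Balaban1985UV3, (5)-(6) pp.256-257] -/
theorem quotient_lower_ae {h : X → ℝ} (hi : Integrable h μ) (h0 : ∀ x, 0 ≤ h x) {S : Set X} (hS : MeasurableSet S) (hSpos : 0 < μ.real S)
    {w M m : ℝ} (hw : 0 < w) (hm : 0 < m) (hup : ∀ᵐ x ∂μ, w * h x ≤ M) (hlow : ∀ᵐ x ∂μ, x ∈ S → m ≤ w * h x) :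
    ∀ᵐ x ∂μ, x ∈ S → m / M ≤ (∫ y, h y ∂μ)⁻¹ * h x := by
  obtain ⟨hZlow, hZup⟩ := twoSided_integral_bounds hi h0 hS hw hup hlow
  have hmS : 0 < m * μ.real S := mul_pos hm hSpos
  have hwZ : 0 < w * ∫ y, h y ∂μ := lt_of_lt_of_le hmS hZlow
  filter_upwards [hlow] with x hx hxS
  have hq : (∫ y, h y ∂μ)⁻¹ * h x = (w * h x) / (w * ∫ y, h y ∂μ) := by
    rw [mul_div_mul_left _ _ hw.ne', div_eq_inv_mul]
  rw [hq]
  calc m / M ≤ m / (w * ∫ y, h y ∂μ) := div_le_div_of_nonneg_left hm.le hwZ hZup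
    _ ≤ w * h x / (w * ∫ y, h y ∂μ) := div_le_div_of_nonneg_right (hx hxS) hwZ.le

end Generic

/-! ## §3 The schemas of `T3HeightwiseDensityBounds` from Theorem 1 (5), both halves, in Bałaban's normalisation -/

/-- The window `{PlaqSmall δ}` has positive REAL product-Haar mass (`δ > 0`; ✓`fieldMeasure_plaqSmall_pos`). [cite: Balaban1985Averaging, (10) p.19] -/
theorem measureReal_plaqSmall_pos (P : Params) (j : ℕ) {δ : ℝ} (hδ : 0 < δ) :
    0 < (fieldMeasure P j (Matrix.specialUnitaryGroup (Fin 2) ℂ)).real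
      {U : GaugeField P j (Matrix.specialUnitaryGroup (Fin 2) ℂ) | PlaqSmall δ U} :=
  ENNReal.toReal_pos (fieldMeasure_plaqSmall_pos (P := P) (j := j) hδ).ne' (measure_ne_top _ _)

/-- The window `{PlaqSmall δ}` is measurable (it is open; here via the measurable plaquette predicate ✓`measurableSet_plaqSmall`). [cite: Balaban1985Averaging, (10) p.19] -/
theorem measurableSet_plaqSmall_window (P : Params) (j : ℕ) (δ : ℝ) :
    MeasurableSet {U : GaugeField P j (Matrix.specialUnitaryGroup (Fin 2) ℂ) | PlaqSmall δ U} :=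
  measurableSet_plaqSmall _

/-- ★★ **(6) FROM (5), BOTH HALVES AT HEIGHT 0** — lit `PartitionBounds6 F γ E` VERBATIM: `Bounds5UpperAtHeight F γ E` (its height-`0` instance) and the
(5)-LOWER letter on the unit-lattice small set `{PlaqSmall δ}` in the SAME normalisation `e^{−E_K}` give `exp(−O1·|T₁|) ≤ e^{−E_K}Z_K ≤ exp(O1·|T₁|)` for all runs
`K` with ONE `O1` — exactly print's derivation of (6) p. 257 («∫dU ρ_k = … = Z^ε … imply uniform in ε bounds»), the window charge `dU_0{PlaqSmall δ} > 0` being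
`K`-free. [cite: Balaban1985UV3, (5) p.256 and (6) p.257] -/
theorem partitionBounds6_of_bounds5TwoSided {F : T3Family} {γ : ℝ} (hγ : 0 ≤ γ) {E : ℕ → ℝ} (h5 : Bounds5UpperAtHeight F γ E)
    (h5low0 : ∃ δ c : ℝ, 0 < δ ∧ 0 < c ∧ ∀ (K : ℕ),
      ∀ᵐ V ∂(fieldMeasure (F.P 0) 0 (Matrix.specialUnitaryGroup (Fin 2) ℂ)), PlaqSmall δ V →
        c ≤ Real.exp (-E K) * heightDensity F γ (Nat.zero_le K) Set.univ V) :
    PartitionBounds6 F γ E := by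
  obtain ⟨O1, hO1⟩ := h5 0
  obtain ⟨δ, c, hδ, hc, hlow⟩ := h5low0
  haveI := isProbabilityMeasure_fieldMeasure (G := Matrix.specialUnitaryGroup (Fin 2) ℂ) (F.P 0) 0
  set N : ℝ := ((F.P 0).sitesPerDir 0 : ℝ) with hN
  set p : ℝ := (fieldMeasure (F.P 0) 0 (Matrix.specialUnitaryGroup (Fin 2) ℂ)).real
    {U : GaugeField (F.P 0) 0 (Matrix.specialUnitaryGroup (Fin 2) ℂ) | PlaqSmall δ U} with hp
  have hppos : 0 < p := measureReal_plaqSmall_pos (F.P 0) 0 hδ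
  have hN0 : 0 < N := by
    rw [hN]
    exact_mod_cast Nat.pos_of_ne_zero ((F.P 0).sitesPerDir_ne_zero 0)
  have hN3 : 0 < N ^ 3 := pow_pos hN0 3
  -- the two-sided bounds of `e^{−E_K} Z_K`, uniformly in `K`
  have hZ : ∀ K : ℕ, c * p ≤ Real.exp (-E K) * partitionFn (G := Matrix.specialUnitaryGroup (Fin 2) ℂ) (F.P K) ((F.scheme ℰp γ).β K) ∧
      Real.exp (-E K) * partitionFn (G := Matrix.specialUnitaryGroup (Fin 2) ℂ) (F.P K) ((F.scheme ℰp γ).β K) ≤ Real.exp (O1 * N ^ 3) := by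
    intro K
    obtain ⟨hdm, hdi⟩ := heightDensity_props F (Nat.zero_le K) MeasurableSet.univ hγ
    have h := twoSided_integral_bounds (μ := fieldMeasure (F.P 0) 0 (Matrix.specialUnitaryGroup (Fin 2) ℂ)) hdi
      (heightDensity_nonneg F γ (Nat.zero_le K) Set.univ) (measurableSet_plaqSmall_window (F.P 0) 0 δ) (Real.exp_pos (-E K))
      (hO1 K (Nat.zero_le K)) (hlow K)
    rwa [integral_heightDensity_univ_eq_partitionFn F hγ (Nat.zero_le K)] at h
  -- one constant for both sides
  refine ⟨max O1 (-(Real.log (c * p)) / N ^ 3), fun K => ⟨?_, ?_⟩⟩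
  · calc Real.exp (-(max O1 (-(Real.log (c * p)) / N ^ 3) * N ^ 3))
        ≤ Real.exp (-(-(Real.log (c * p)) / N ^ 3 * N ^ 3)) := by
          apply Real.exp_le_exp.mpr
          apply neg_le_neg
          exact mul_le_mul_of_nonneg_right (le_max_right _ _) hN3.le
      _ = c * p := by
          rw [div_mul_cancel₀ _ hN3.ne', neg_neg, Real.exp_log (mul_pos hc hppos)]
      _ ≤ _ := (hZ K).1
  · calc Real.exp (-E K) * partitionFn (G := Matrix.specialUnitaryGroup (Fin 2) ℂ) (F.P K) ((F.scheme ℰp γ).β K)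
        ≤ Real.exp (O1 * N ^ 3) := (hZ K).2
      _ ≤ Real.exp (max O1 (-(Real.log (c * p)) / N ^ 3) * N ^ 3) := by
          apply Real.exp_le_exp.mpr
          exact mul_le_mul_of_nonneg_right (le_max_left _ _) hN3.le

/-- ★★★ **⟨UP⟩'S SCHEMA FROM (5), BOTH HALVES** — lit `HeightwiseUpperBound F γ` VERBATIM from `Bounds5UpperAtHeight F γ E` + the (5)-LOWER letter on the
unit-lattice small set (normalisation `E`): lit ✓`heightwiseUpperBound_of_bounds5` ∘ `partitionBounds6_of_bounds5TwoSided` — (6) is no longer an input.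
[cite: Balaban1985UV3, (5) p.256, (6) p.257, Thm 1 p.257] -/
theorem heightwiseUpperBound_of_bounds5TwoSided {F : T3Family} {γ : ℝ} (hγ : 0 ≤ γ) {E : ℕ → ℝ} (h5 : Bounds5UpperAtHeight F γ E)
    (h5low0 : ∃ δ c : ℝ, 0 < δ ∧ 0 < c ∧ ∀ (K : ℕ),
      ∀ᵐ V ∂(fieldMeasure (F.P 0) 0 (Matrix.specialUnitaryGroup (Fin 2) ℂ)), PlaqSmall δ V →
        c ≤ Real.exp (-E K) * heightDensity F γ (Nat.zero_le K) Set.univ V) :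
    HeightwiseUpperBound F γ :=
  heightwiseUpperBound_of_bounds5 hγ h5 (partitionBounds6_of_bounds5TwoSided hγ h5 h5low0)

/-- ★★★ **⟨LOW ON SMALL⟩'S SCHEMA FROM (5), BOTH HALVES** — lit `HeightwiseLowerBoundOnSmall F γ` VERBATIM: at every height `n`, the (5)-LOWER letter on
`{PlaqSmall δ_n}` in Bałaban's normalisation (`c ≤ e^{−E_K}ρ_{K−n}` a.e. there) together with the (5)-UPPER letter at the SAME height (`Bounds5UpperAtHeight`,
giving `e^{−E_K}Z_K ≤ exp(O1·|T₁^{(K−n)}|)` through §1) yields `c·exp(−O1·|T₁^{(K−n)}|) ≤ Z_K⁻¹ρ_{K−n}` a.e. on the small set — `E_K` cancels; `K`-free constants.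
[cite: Balaban1985UV3, (5) p.256, (47) p.267, Thm 1 p.257] -/
theorem heightwiseLowerBoundOnSmall_of_bounds5TwoSided {F : T3Family} {γ : ℝ} (hγ : 0 ≤ γ) {E : ℕ → ℝ} (h5 : Bounds5UpperAtHeight F γ E)
    (h5low : ∀ n : ℕ, ∃ δ c : ℝ, 0 < δ ∧ 0 < c ∧ ∀ (K : ℕ) (hK : n ≤ K),
      ∀ᵐ V ∂(fieldMeasure (F.P n) 0 (Matrix.specialUnitaryGroup (Fin 2) ℂ)), PlaqSmall δ V →
        c ≤ Real.exp (-E K) * heightDensity F γ hK Set.univ V) :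
    HeightwiseLowerBoundOnSmall F γ := by
  intro n
  obtain ⟨O1, hO1⟩ := h5 n
  obtain ⟨δ, c, hδ, hc, hlow⟩ := h5low n
  haveI := isProbabilityMeasure_fieldMeasure (G := Matrix.specialUnitaryGroup (Fin 2) ℂ) (F.P n) 0
  have hppos := measureReal_plaqSmall_pos (F.P n) 0 hδ
  refine ⟨δ, c / Real.exp (O1 * ((F.P n).sitesPerDir 0 : ℝ) ^ 3), hδ, div_pos hc (Real.exp_pos _), fun K hK => ?_⟩
  obtain ⟨hdm, hdi⟩ := heightDensity_props F hK MeasurableSet.univ hγ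
  have h := quotient_lower_ae (μ := fieldMeasure (F.P n) 0 (Matrix.specialUnitaryGroup (Fin 2) ℂ)) hdi
    (heightDensity_nonneg F γ hK Set.univ) (measurableSet_plaqSmall_window (F.P n) 0 δ) hppos (Real.exp_pos (-E K)) hc
    (hO1 K hK) (hlow K hK)
  rw [integral_heightDensity_univ_eq_partitionFn F hγ hK] at h
  filter_upwards [h] with V hV hVs
  exact hV hVs

/-- ★★ **THE QUOTIENT UPPER LETTER AT ONE HEIGHT, DIRECTLY** (no detour through (6) at height 0): (5) both halves at height `n` ⟹ `Z_K⁻¹ρ_{K−n} ≤ C_n` a.e. with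
`C_n = exp(O1·|T₁^{(K−n)}|)∕(c·dU_n{PlaqSmall δ})`, `K`-free. [cite: Balaban1985UV3, (5) p.256, Thm 1 p.257] -/
theorem heightwiseUpper_at_of_bounds5TwoSided {F : T3Family} {γ : ℝ} (hγ : 0 ≤ γ) {E : ℕ → ℝ} {n : ℕ} {O1 δ c : ℝ} (hδ : 0 < δ) (hc : 0 < c)
    (hup : ∀ (K : ℕ) (hK : n ≤ K), ∀ᵐ V ∂(fieldMeasure (F.P n) 0 (Matrix.specialUnitaryGroup (Fin 2) ℂ)),
      Real.exp (-E K) * heightDensity F γ hK Set.univ V ≤ Real.exp (O1 * ((F.P n).sitesPerDir 0 : ℝ) ^ 3))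
    (hlow : ∀ (K : ℕ) (hK : n ≤ K), ∀ᵐ V ∂(fieldMeasure (F.P n) 0 (Matrix.specialUnitaryGroup (Fin 2) ℂ)), PlaqSmall δ V →
      c ≤ Real.exp (-E K) * heightDensity F γ hK Set.univ V) :
    ∀ (K : ℕ) (hK : n ≤ K), ∀ᵐ V ∂(fieldMeasure (F.P n) 0 (Matrix.specialUnitaryGroup (Fin 2) ℂ)),
      (partitionFn (G := Matrix.specialUnitaryGroup (Fin 2) ℂ) (F.P K) ((F.scheme ℰp γ).β K))⁻¹ * heightDensity F γ hK Set.univ V ≤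
        Real.exp (O1 * ((F.P n).sitesPerDir 0 : ℝ) ^ 3) /
          (c * (fieldMeasure (F.P n) 0 (Matrix.specialUnitaryGroup (Fin 2) ℂ)).real
            {U : GaugeField (F.P n) 0 (Matrix.specialUnitaryGroup (Fin 2) ℂ) | PlaqSmall δ U}) := by
  intro K hK
  haveI := isProbabilityMeasure_fieldMeasure (G := Matrix.specialUnitaryGroup (Fin 2) ℂ) (F.P n) 0
  obtain ⟨hdm, hdi⟩ := heightDensity_props F hK MeasurableSet.univ hγ
  have h := quotient_upper_ae (μ := fieldMeasure (F.P n) 0 (Matrix.specialUnitaryGroup (Fin 2) ℂ)) hdi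
    (heightDensity_nonneg F γ hK Set.univ) (measurableSet_plaqSmall_window (F.P n) 0 δ) (measureReal_plaqSmall_pos (F.P n) 0 hδ)
    (Real.exp_pos (-E K)) hc (hup K hK) (hlow K hK)
  rwa [integral_heightDensity_univ_eq_partitionFn F hγ hK] at h

/-! ## §4 Print's literal lower currency: the constrained minimiser's action and the regularity letter -/

/-- ★ **THE FOLDED LOWER LETTER FROM PRINT'S MINIMISER SHAPE + REGULARITY**: (5)'s lower half reads `χ(U)·exp[−(1∕g_k²)A^η(U_k(U)) − O(1)|T₁^{(k)}|] ≤ ρ_k(U)`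
with `U_k(U)` the constrained minimiser of the fine Wilson action over the fibre of `U` ([Balaban1985UV3] p. 256, [7] = [Balaban1985Variational]); on the tower
`(1∕g_k²)A^η(U_k(U)) = β_K·minAction F ℰp n K hK V` (lit `T3ConstrainedMinimiser.minAction`).  If on the small set the minimiser's action is `K`-UNIFORMLY bounded,
`β_K·minAction ≤ A₀` (the REGULARITY letter — [Balaban1985Variational] Thm 1 read on `{PlaqSmall δ}`; displayed, NOT proved), then the folded letter of §3 holds with
`c := exp(−A₀ − O1·|T₁^{(K−n)}|)`. [cite: Balaban1985UV3, (5) p.256 and (47) p.267; Balaban1985Variational, Thm 1 p.279] -/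
theorem bounds5LowerOnSmall_of_minimiserShape {F : T3Family} {γ : ℝ} {E : ℕ → ℝ}
    (h : ∀ n : ℕ, ∃ δ O1 A₀ : ℝ, 0 < δ ∧ ∀ (K : ℕ) (hK : n ≤ K),
      (∀ᵐ V ∂(fieldMeasure (F.P n) 0 (Matrix.specialUnitaryGroup (Fin 2) ℂ)), PlaqSmall δ V →
        Real.exp (-((F.scheme ℰp γ).β K * minAction F ℰp n K hK V) - O1 * ((F.P n).sitesPerDir 0 : ℝ) ^ 3) ≤
          Real.exp (-E K) * heightDensity F γ hK Set.univ V) ∧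
      (∀ V : GaugeField (F.P n) 0 (Matrix.specialUnitaryGroup (Fin 2) ℂ), PlaqSmall δ V →
        (F.scheme ℰp γ).β K * minAction F ℰp n K hK V ≤ A₀)) :
    ∀ n : ℕ, ∃ δ c : ℝ, 0 < δ ∧ 0 < c ∧ ∀ (K : ℕ) (hK : n ≤ K),
      ∀ᵐ V ∂(fieldMeasure (F.P n) 0 (Matrix.specialUnitaryGroup (Fin 2) ℂ)), PlaqSmall δ V →
        c ≤ Real.exp (-E K) * heightDensity F γ hK Set.univ V := by
  intro n
  obtain ⟨δ, O1, A₀, hδ, hK'⟩ := h n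
  refine ⟨δ, Real.exp (-A₀ - O1 * ((F.P n).sitesPerDir 0 : ℝ) ^ 3), hδ, Real.exp_pos _, fun K hK => ?_⟩
  obtain ⟨hae, hreg⟩ := hK' K hK
  filter_upwards [hae] with V hV hVs
  refine le_trans (Real.exp_le_exp.mpr ?_) (hV hVs)
  have := hreg V hVs
  linarith

/-- ★ **AND CONVERSELY THE MINIMISER IS CHEAP TO BOUND FROM ANY FIBRE POINT**: `minAction ≤ wilsonAction4 U` for every fine field `U` over `V` (lit ✓`minAction_le`), so the
regularity letter `β_K·minAction ≤ A₀` on the small set follows from exhibiting, for each small `V`, ONE fine field over it with `β_K·A(U) ≤ A₀` (a smooth interpolant —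
[Balaban1985Variational] (9)∕Thm 1 supplies the minimiser itself). Bookkeeping. [cite: Balaban1985Variational, Thm 1 p.279] -/
theorem regularityLetter_of_fibrePoint {F : T3Family} {γ : ℝ} {n K : ℕ} (hK : n ≤ K) {δ A₀ : ℝ}
    (h : ∀ V : GaugeField (F.P n) 0 (Matrix.specialUnitaryGroup (Fin 2) ℂ), PlaqSmall δ V →
      ∃ U : GaugeField (F.P K) 0 (Matrix.specialUnitaryGroup (Fin 2) ℂ), descendTo F ℰp n K hK U = V ∧
        (F.scheme ℰp γ).β K * wilsonAction4 U ≤ A₀) (hβ : 0 ≤ (F.scheme ℰp γ).β K) :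
    ∀ V : GaugeField (F.P n) 0 (Matrix.specialUnitaryGroup (Fin 2) ℂ), PlaqSmall δ V →
      (F.scheme ℰp γ).β K * minAction F ℰp n K hK V ≤ A₀ := by
  intro V hV
  obtain ⟨U, hU, hA⟩ := h V hV
  exact (mul_le_mul_of_nonneg_left (minAction_le F ℰp hU) hβ).trans hA

end Summit.QuantumFields.YangMills.Theorems.FluctuationComparisonRegPrIntLHeightwiseQuotientOfBounds5

end
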